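import Summits.Ventures.PercRepro.ForceSet

/-!
# PercRepro — the `Z`-fibre certificate for Lemma 5 (p6, gen 5)

`ForceSet.lean` writes the concavity slack `Q⁺(Δ_g, Δ_g)` of the C-011 slack along `g` as the
nested decomposition over any edge set `R ∌ g`: `Σ_{I ⊆ U ⊆ R} w_R(I) w_R(U) · N_R(I, U)`.  Here a
SECOND edge set `Z` (disjoint from `R`, `g ∉ Z`) is used to expand each nested sum over the
`2^|Z|` patterns of `Z`:

`N_R(I, U) = Σ_{z, z′ ⊆ Z} P(z) P(z′) · F_{IU}(z, z′)`,   `F_{IU}(z, z′) = Σ_{ρ∩ρ′=I, ρ∪ρ′=U} Q⁺(Δ_{ρ∪z}, Δ_{ρ′∪z′})`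

(`nestedSum_eq_sum_fibreKernel`; `Δ_A` = the merge vector of the weights forced on `R ∪ Z` to `A`),
so that **`deltaQuad_nonpos_of_fibreKernel`**: if every body class `(I, U)` has a nonpositive
quadratic form `Σ_{z,z′} P(z) P(z′) F_{IU}(z, z′)` in the pattern weights of `Z`, then
`Q⁺(Δ_g, Δ_g) ≤ 0` — the kernel form of the «fibre AM-GM» certificate (`proofs/P6-attach-fibre.md`
§1–§2, `LEAD-C011-concavity.md` §10.15).  `Z = ∅` is the class-level statement (typer-2's
`ClassSumNonneg`), `R = ∅` is no decomposition; when `R ∪ Z` is every edge but `g` the fibre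
kernels are constants (integer matrices — `GadgetLemma5.lean` evaluates them on the gadget).

Also here: the two forcing lemmas `forcePat_forcePat` / `patWeight_forcePat`, the parametrisation
`sum_fibre_eq` of the fibre `{(ρ, ρ′) : ρ ∩ ρ′ = I, ρ ∪ ρ′ = U}` by the subsets of `U ∖ I`, the
two-argument bilinearity `quadPlus_sum_sum'`, and the copositivity lemma `sum_nonpos_of_block`
(all entries `≤ 0` except one `2 × 2` block `[[−2, 1], [1, −2]]`-dominated), and
`nestedSum_insert_eq_crossTwo`: a nested class with ONE differing edge `t` is twice the level-1 cross
term `crossTwo` of the minor forced on `S ∖ {t}` — the `|U ∖ I| = 1` classes of the star step are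
inductive (`proofs/P6-attach-fibre.md` §8).
-/

namespace PercRepro

open Finset

/-! ### General lemmas: composing forcings, the fibre parametrisation, bilinearity, one block -/

section General

variable {E : Type*} [DecidableEq E]

/-- Forcing `T` after forcing `S` (disjoint from `T`) is forcing `S ∪ T` to the union pattern. -/
theorem forcePat_forcePat (p : E → ℝ) {S T A B : Finset E} (hST : Disjoint S T) (hA : A ⊆ S)
    (hB : B ⊆ T) : forcePat (forcePat p S A) T B = forcePat p (S ∪ T) (A ∪ B) := by
  funext e
  simp only [forcePat, Finset.mem_union]
  by_cases heT : e ∈ T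
  · have heS : e ∉ S := Finset.disjoint_right.mp hST heT
    have heA : e ∉ A := fun h => heS (hA h)
    simp [heT, heS, heA]
  · by_cases heS : e ∈ S
    · have heB : e ∉ B := fun h => heT (hB h)
      simp [heT, heS, heB]
    · simp [heT, heS]

/-- The pattern weights on `T` of a weight vector forced on `S` (disjoint from `T`) are those of
`p`. -/
theorem patWeight_forcePat (p : E → ℝ) {S T : Finset E} (hST : Disjoint S T) (A B : Finset E) :
    patWeight (forcePat p S A) T B = patWeight p T B := by
  unfold patWeight
  refine Finset.prod_congr rfl fun e he => ?_
  have heS : e ∉ S := Finset.disjoint_right.mp hST he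
  simp [forcePat, heS]

/-- The fibre of `(I, U)` under `(A, A′) ↦ (A ∩ A′, A ∪ A′)` on `S.powerset²` is parametrised by the
subsets `τ ⊆ U \ I` (the differing edges open in the first copy). -/
theorem sum_fibre_eq {β : Type*} [AddCommMonoid β] (S : Finset E) {I U : Finset E} (hI : I ⊆ U)
    (hU : U ⊆ S) (f : Finset E × Finset E → β) :
    ∑ AA ∈ (S.powerset ×ˢ S.powerset).filter
        (fun AA : Finset E × Finset E => (AA.1 ∩ AA.2, AA.1 ∪ AA.2) = (I, U)), f AA =
      ∑ τ ∈ (U \ I).powerset, f (I ∪ τ, I ∪ ((U \ I) \ τ)) := by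
  symm
  refine Finset.sum_nbij' (fun τ => (I ∪ τ, I ∪ ((U \ I) \ τ))) (fun AA => AA.1 \ I) ?_ ?_ ?_ ?_ ?_
  · intro τ hτ
    have hτ' : τ ⊆ U \ I := Finset.mem_powerset.mp hτ
    refine Finset.mem_filter.mpr ⟨Finset.mem_product.mpr ⟨?_, ?_⟩, ?_⟩
    · exact Finset.mem_powerset.mpr
        (Finset.union_subset (hI.trans hU) ((hτ'.trans Finset.sdiff_subset).trans hU))
    · exact Finset.mem_powerset.mpr
        (Finset.union_subset (hI.trans hU) ((Finset.sdiff_subset.trans Finset.sdiff_subset).trans hU))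
    · simp only [Prod.mk.injEq]
      constructor
      · ext e
        simp only [Finset.mem_inter, Finset.mem_union, Finset.mem_sdiff]
        constructor
        · rintro ⟨h1, h2⟩
          rcases h1 with h1 | h1
          · exact h1
          · rcases h2 with h2 | h2
            · exact h2
            · exact absurd h1 h2.2
        · intro h
          exact ⟨Or.inl h, Or.inl h⟩
      · ext e
        simp only [Finset.mem_union, Finset.mem_sdiff]
        constructor
        · rintro ((h | h) | (h | h))
          · exact hI h
          · exact (Finset.mem_sdiff.mp (hτ' h)).1
          · exact hI h
          · exact h.1.1
        · intro h
          by_cases hi : e ∈ I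
          · exact Or.inl (Or.inl hi)
          · by_cases ht : e ∈ τ
            · exact Or.inl (Or.inr ht)
            · exact Or.inr (Or.inr ⟨⟨h, hi⟩, ht⟩)
  · intro AA hAA
    have h := (Finset.mem_filter.mp hAA).2
    simp only [Prod.mk.injEq] at h
    refine Finset.mem_powerset.mpr fun e he => ?_
    have he' := Finset.mem_sdiff.mp he
    refine Finset.mem_sdiff.mpr ⟨?_, he'.2⟩
    rw [← h.2]
    exact Finset.mem_union_left _ he'.1
  · intro τ hτ
    have hτ' : τ ⊆ U \ I := Finset.mem_powerset.mp hτ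
    ext e
    simp only [Finset.mem_sdiff, Finset.mem_union]
    constructor
    · rintro ⟨h | h, hi⟩
      · exact absurd h hi
      · exact h
    · intro h
      exact ⟨Or.inr h, (Finset.mem_sdiff.mp (hτ' h)).2⟩
  · intro AA hAA
    have h := (Finset.mem_filter.mp hAA).2
    simp only [Prod.mk.injEq] at h
    have hI1 : I ⊆ AA.1 := by rw [← h.1]; exact Finset.inter_subset_left
    have hI2 : I ⊆ AA.2 := by rw [← h.1]; exact Finset.inter_subset_right
    refine Prod.ext ?_ ?_
    · exact Finset.union_sdiff_of_subset hI1
    · show I ∪ ((U \ I) \ (AA.1 \ I)) = AA.2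
      ext e
      simp only [Finset.mem_union, Finset.mem_sdiff, not_and, not_not]
      constructor
      · rintro (hi | ⟨⟨hu, hi⟩, h1⟩)
        · exact hI2 hi
        · have hu' : e ∈ AA.1 ∪ AA.2 := by rw [h.2]; exact hu
          rcases Finset.mem_union.mp hu' with h1' | h2'
          · exact absurd (h1 h1') hi
          · exact h2'
      · intro h2
        by_cases hi : e ∈ I
        · exact Or.inl hi
        · refine Or.inr ⟨⟨?_, hi⟩, fun h1 => ?_⟩
          · rw [← h.2]; exact Finset.mem_union_right _ h2
          · have : e ∈ AA.1 ∩ AA.2 := Finset.mem_inter.mpr ⟨h1, h2⟩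
            rw [h.1] at this
            exact absurd this hi
  · intro τ _
    rfl

/-- Copositivity from one dominated block: all entries `≤ 0` except the two off-diagonal entries of
the block `{i₁, i₂}`, which are `≤ 1`, while the block's diagonal entries are `≤ −2`. -/
theorem sum_nonpos_of_block {ι : Type*} [DecidableEq ι] (T : Finset ι) (P : ι → ℝ)
    (hP : ∀ i, 0 ≤ P i) (M : ι → ι → ℝ) {i₁ i₂ : ι} (h₁ : i₁ ∈ T) (h₂ : i₂ ∈ T) (hne : i₁ ≠ i₂)
    (hoff : ∀ i ∈ T, ∀ j ∈ T, ¬ ((i = i₁ ∧ j = i₂) ∨ (i = i₂ ∧ j = i₁)) → M i j ≤ 0)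
    (h11 : M i₁ i₁ ≤ -2) (h22 : M i₂ i₂ ≤ -2) (h12 : M i₁ i₂ ≤ 1) (h21 : M i₂ i₁ ≤ 1) :
    ∑ i ∈ T, ∑ j ∈ T, P i * P j * M i j ≤ 0 := by
  rw [← Finset.sum_product']
  have m12 : (i₁, i₂) ∈ T ×ˢ T := Finset.mem_product.mpr ⟨h₁, h₂⟩
  have m21 : (i₂, i₁) ∈ (T ×ˢ T).erase (i₁, i₂) :=
    Finset.mem_erase.mpr ⟨fun h => hne (Prod.mk.inj h).1.symm, Finset.mem_product.mpr ⟨h₂, h₁⟩⟩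
  have m11 : (i₁, i₁) ∈ ((T ×ˢ T).erase (i₁, i₂)).erase (i₂, i₁) :=
    Finset.mem_erase.mpr ⟨fun h => hne (Prod.mk.inj h).1,
      Finset.mem_erase.mpr ⟨fun h => hne (Prod.mk.inj h).2, Finset.mem_product.mpr ⟨h₁, h₁⟩⟩⟩
  have m22 : (i₂, i₂) ∈ (((T ×ˢ T).erase (i₁, i₂)).erase (i₂, i₁)).erase (i₁, i₁) :=
    Finset.mem_erase.mpr ⟨fun h => hne (Prod.mk.inj h).1.symm,
      Finset.mem_erase.mpr ⟨fun h => hne (Prod.mk.inj h).2.symm,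
        Finset.mem_erase.mpr ⟨fun h => hne (Prod.mk.inj h).1.symm,
          Finset.mem_product.mpr ⟨h₂, h₂⟩⟩⟩⟩
  rw [← Finset.add_sum_erase _ _ m12, ← Finset.add_sum_erase _ _ m21,
    ← Finset.add_sum_erase _ _ m11, ← Finset.add_sum_erase _ _ m22]
  have hrest : ∑ ij ∈ ((((T ×ˢ T).erase (i₁, i₂)).erase (i₂, i₁)).erase (i₁, i₁)).erase (i₂, i₂),
      P ij.1 * P ij.2 * M ij.1 ij.2 ≤ 0 := by
    refine Finset.sum_nonpos fun ij hij => ?_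
    have h := Finset.mem_erase.mp hij
    have h' := Finset.mem_erase.mp h.2
    have h'' := Finset.mem_erase.mp h'.2
    have h''' := Finset.mem_erase.mp h''.2
    obtain ⟨hi, hj⟩ := Finset.mem_product.mp h'''.2
    refine mul_nonpos_of_nonneg_of_nonpos (mul_nonneg (hP _) (hP _)) (hoff _ hi _ hj ?_)
    rintro (⟨e1, e2⟩ | ⟨e1, e2⟩)
    · exact h'''.1 (Prod.ext e1 e2)
    · exact h''.1 (Prod.ext e1 e2)
  dsimp only
  have hp1 := hP i₁
  have hp2 := hP i₂
  have e1 : P i₁ * P i₂ * M i₁ i₂ ≤ P i₁ * P i₂ * 1 :=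
    mul_le_mul_of_nonneg_left h12 (mul_nonneg hp1 hp2)
  have e2 : P i₂ * P i₁ * M i₂ i₁ ≤ P i₂ * P i₁ * 1 :=
    mul_le_mul_of_nonneg_left h21 (mul_nonneg hp2 hp1)
  have e3 : P i₁ * P i₁ * M i₁ i₁ ≤ P i₁ * P i₁ * (-2) :=
    mul_le_mul_of_nonneg_left h11 (mul_nonneg hp1 hp1)
  have e4 : P i₂ * P i₂ * M i₂ i₂ ≤ P i₂ * P i₂ * (-2) :=
    mul_le_mul_of_nonneg_left h22 (mul_nonneg hp2 hp2)
  nlinarith [sq_nonneg (P i₁ - P i₂), hrest, e1, e2, e3, e4]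

/-- `Q⁺` is bilinear over two finite sums (the two-argument form of `quadPlus_sum_sum`). -/
theorem quadPlus_sum_sum' {ι κ : Type*} (S : Finset ι) (T : Finset κ) (c : ι → ℝ) (c' : κ → ℝ)
    (u : ι → Fin 15 → ℝ) (v : κ → Fin 15 → ℝ) :
    quadPlus (fun r => ∑ ω ∈ S, c ω * u ω r) (fun r => ∑ ω' ∈ T, c' ω' * v ω' r) =
      ∑ ω ∈ S, ∑ ω' ∈ T, c ω * c' ω' * quadPlus (u ω) (v ω') := by
  simp only [quadPlus_eq_kplus]
  rw [kernelForm_sum_left]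
  simp only [kernelForm_sum_right]
  simp only [Finset.mul_sum]
  refine Finset.sum_congr rfl fun ω _ => Finset.sum_congr rfl fun ω' _ => ?_
  ring

end General

/-! ### The `Z`-fibre certificate for an arbitrary multigraph -/

namespace MultiGraph

variable {V E : Type*} (G : MultiGraph V E) [Fintype E] [DecidableEq E]

/-- **The `Z`-fibre kernel of the body class `(I, U)`** at the `Z`-patterns `(z, z′)`: the sum, over
the ordered pairs `(ρ, ρ′)` of body patterns with `ρ ∩ ρ′ = I` and `ρ ∪ ρ′ = U`, of
`Q⁺(Δ_{ρ ∪ z}, Δ_{ρ′ ∪ z′})`, the merge vectors of the weights forced on `R ∪ Z`.  When `R ∪ Z` is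
every edge but `g` these are constants (the integer fibre matrices); in general they are
polynomials in the remaining weights. -/
noncomputable def fibreKernel (p : E → ℝ) (R Z : Finset E) (g : E) (a b c d : V)
    (I U z z' : Finset E) : ℝ :=
  ∑ AA ∈ (R.powerset ×ˢ R.powerset).filter
      (fun AA : Finset E × Finset E => (AA.1 ∩ AA.2, AA.1 ∪ AA.2) = (I, U)),
    quadPlus (G.deltaVec (forcePat p (R ∪ Z) (AA.1 ∪ z)) g a b c d)
      (G.deltaVec (forcePat p (R ∪ Z) (AA.2 ∪ z')) g a b c d)

/-- **A nested sum of the body expands over the `Z`-fibres**: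
`N_R(I, U) = Σ_{z, z′ ⊆ Z} P(z) P(z′) · fibreKernel I U z z′` (`R`, `Z` disjoint, `g ∉ Z`). -/
theorem nestedSum_eq_sum_fibreKernel (p : E → ℝ) {R Z : Finset E} (hRZ : Disjoint R Z) {g : E}
    (hgZ : g ∉ Z) (a b c d : V) (I U : Finset E) :
    G.nestedSum p R g a b c d I U = ∑ z ∈ Z.powerset, ∑ z' ∈ Z.powerset,
      patWeight p Z z * patWeight p Z z' * G.fibreKernel p R Z g a b c d I U z z' := by
  unfold nestedSum fibreKernel
  have key : ∀ AA ∈ (R.powerset ×ˢ R.powerset).filter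
      (fun AA : Finset E × Finset E => (AA.1 ∩ AA.2, AA.1 ∪ AA.2) = (I, U)),
      quadPlus (G.deltaVec (forcePat p R AA.1) g a b c d) (G.deltaVec (forcePat p R AA.2) g a b c d) =
        ∑ z ∈ Z.powerset, ∑ z' ∈ Z.powerset, patWeight p Z z * patWeight p Z z' *
          quadPlus (G.deltaVec (forcePat p (R ∪ Z) (AA.1 ∪ z)) g a b c d)
            (G.deltaVec (forcePat p (R ∪ Z) (AA.2 ∪ z')) g a b c d) := by
    intro AA hAA
    obtain ⟨h1, h2⟩ := Finset.mem_product.mp (Finset.mem_filter.mp hAA).1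
    have hA1 : AA.1 ⊆ R := Finset.mem_powerset.mp h1
    have hA2 : AA.2 ⊆ R := Finset.mem_powerset.mp h2
    rw [G.deltaVec_eq_sum_forcePat (forcePat p R AA.1) hgZ,
      G.deltaVec_eq_sum_forcePat (forcePat p R AA.2) hgZ, quadPlus_sum_sum']
    refine Finset.sum_congr rfl fun z hz => Finset.sum_congr rfl fun z' hz' => ?_
    have hz1 : z ⊆ Z := Finset.mem_powerset.mp hz
    have hz2 : z' ⊆ Z := Finset.mem_powerset.mp hz'
    rw [patWeight_forcePat p hRZ, patWeight_forcePat p hRZ, forcePat_forcePat p hRZ hA1 hz1,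
      forcePat_forcePat p hRZ hA2 hz2]
  rw [Finset.sum_congr rfl key]
  refine Eq.trans Finset.sum_comm ?_
  refine Finset.sum_congr rfl fun z _ => ?_
  refine Eq.trans Finset.sum_comm ?_
  refine Finset.sum_congr rfl fun z' _ => ?_
  rw [Finset.mul_sum]

/-- **Lemma 5 from copositive `Z`-fibre kernels**: if, for every body class `(I, U)`, the quadratic
form of its `Z`-fibre kernel in the pattern weights of `Z` is nonpositive, then
`Q⁺(Δ_g, Δ_g) ≤ 0` — the «fibre AM-GM» certificate of `proofs/P6-attach-fibre.md` §1–§2 in the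
kernel; `Z = ∅` is the class-level statement, `R = ∅` is no decomposition at all. -/
theorem deltaQuad_nonpos_of_fibreKernel {p : E → ℝ} (hp : IsProb p) {R Z : Finset E}
    (hRZ : Disjoint R Z) {g : E} (hgR : g ∉ R) (hgZ : g ∉ Z) (a b c d : V)
    (h : ∀ I ∈ R.powerset, ∀ U ∈ R.powerset, ∑ z ∈ Z.powerset, ∑ z' ∈ Z.powerset,
      patWeight p Z z * patWeight p Z z' * G.fibreKernel p R Z g a b c d I U z z' ≤ 0) :
    G.deltaQuad p g a b c d ≤ 0 := by
  rw [G.deltaQuad_eq_sum_nested p hgR]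
  refine Finset.sum_nonpos fun IU hIU => ?_
  obtain ⟨hI, hU⟩ := Finset.mem_product.mp hIU
  refine mul_nonpos_of_nonneg_of_nonpos
    (mul_nonneg (patWeight_nonneg hp _ _) (patWeight_nonneg hp _ _)) ?_
  rw [G.nestedSum_eq_sum_fibreKernel p hRZ hgZ]
  exact h _ hI _ hU

end MultiGraph

/-! ### One differing edge: the nested class is a level-1 cross term -/

section Force

variable {E : Type*} [DecidableEq E]

/-- Forcing `S` to `A` with `t ∈ S ∖ A` is forcing `S ∖ {t}` to `A` and setting `p_t := 0`. -/
theorem forcePat_eq_update_zero (p : E → ℝ) {S A : Finset E} {t : E} (ht : t ∈ S) (hA : t ∉ A) :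
    forcePat p S A = Function.update (forcePat p (S.erase t) A) t 0 := by
  funext e
  by_cases he : e = t
  · subst he; simp [forcePat, ht, hA]
  · simp [forcePat, Finset.mem_erase, he]

/-- Forcing `S` to `insert t A` with `t ∈ S` is forcing `S ∖ {t}` to `A` and setting `p_t := 1`. -/
theorem forcePat_eq_update_one (p : E → ℝ) {S A : Finset E} {t : E} (ht : t ∈ S) (hA : t ∉ A) :
    forcePat p S (insert t A) = Function.update (forcePat p (S.erase t) A) t 1 := by
  funext e
  by_cases he : e = t
  · subst he; simp [forcePat, ht]
  · simp [forcePat, Finset.mem_erase, he]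

end Force

namespace MultiGraph

variable {V E : Type*} (G : MultiGraph V E) [Fintype E] [DecidableEq E]

/-- **A nested class with ONE differing edge is twice the level-1 cross term** of the forced minor
along that edge: `N_S(I, I ∪ {t}) = 2 · crossTwo(p forced on S ∖ {t} to I; g, t)`. -/
theorem nestedSum_insert_eq_crossTwo (p : E → ℝ) {S I : Finset E} {g t : E} (hI : I ⊆ S)
    (ht : t ∈ S) (htI : t ∉ I) (a b c d : V) :
    G.nestedSum p S g a b c d I (insert t I) =
      2 * G.crossTwo (forcePat p (S.erase t) I) g t a b c d := by
  unfold nestedSum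
  have hsub : I ⊆ insert t I := Finset.subset_insert t I
  have hU : insert t I ⊆ S := Finset.insert_subset ht hI
  rw [sum_fibre_eq S hsub hU]
  have hdiff : insert t I \ I = {t} := by
    ext e
    simp only [Finset.mem_sdiff, Finset.mem_insert, Finset.mem_singleton]
    constructor
    · rintro ⟨h | h, hI'⟩
      · exact h
      · exact absurd h hI'
    · rintro rfl
      exact ⟨Or.inl rfl, htI⟩
  rw [hdiff, ← Finset.insert_empty, Finset.sum_powerset_insert (Finset.notMem_empty t),
    Finset.powerset_empty, Finset.sum_singleton, Finset.sum_singleton]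
  dsimp only
  have e1 : I ∪ ∅ = I := Finset.union_empty I
  have e2 : I ∪ (insert t ∅ \ ∅) = insert t I := by
    ext e; simp
  have e3 : I ∪ insert t ∅ = insert t I := by
    ext e; simp
  have e4 : I ∪ (insert t ∅ \ insert t ∅) = I := by simp
  rw [e1, e2, e3, e4, forcePat_eq_update_zero p ht htI, forcePat_eq_update_one p ht htI, crossTwo,
    quadPlus_comm (G.deltaVec (Function.update (forcePat p (S.erase t) I) t 1) g a b c d)]
  ring

end MultiGraph

end PercRepro
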